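import Literature.Analysis.FluidPDE.KNSSTypeIIZoomIn
import Literature.Analysis.FluidPDE.KNSSTypeIRateMildProofs
import Literature.Analysis.FluidPDE.KNSSTypeIRateLimit
import Literature.Analysis.FluidPDE.KNSSTypeIRateLiouvilleHolds
import Literature.Analysis.FluidPDE.AncientMildCompactness
import Literature.Analysis.FluidPDE.BoundedMildSmoothRemainder
import Literature.Analysis.FluidPDE.NSLerayOseenRepresentation
import Literature.Analysis.FluidPDE.NSBoundedMildOseenRestart
import Literature.Analysis.FluidPDE.NSBoundedMildSmoothing
import Literature.Analysis.FluidPDE.KNSSAxisymmetricNoSwirlHolds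
import Summits.NavierStokesRegularity.NavierStokesRegularity.Theorems.CertifiedBlowupCertifiedBlowupAxisymBlowupSwirlPersists
import Summits.NavierStokesRegularity.NavierStokesRegularity.Theorems.CertifiedBlowupCertifiedBlowupAxisymBlowupSwirlOrderParameter
import HarnessLib

/-!
# The blow-up limit with a receding symmetry axis is a constant vector

Theorems file landed `--supports stmt-NavierStokesRegularity-0727` (crux `CertifiedBlowupAxisymBlowup`), line
`compact-amplification` (registered), sub-skeleton "axis-aware KNSS sup-zoom of a witness"
(`Cruxes/CertifiedBlowupAxisymBlowup/Lines/registered_zoom_probe.lean`), continuation lead c5.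
Stub `zoom_limit_const`: a field `W : ℝ → ℝ³ → ℝ³`, jointly continuous and bounded on
`(−∞, 0) × ℝ³`, with weakly divergence-free slices, satisfying the Oseen integral equation
`W(t) = e^{(t−s)Δ} W(s) − B¹_s(W, W)(t)` pointwise for all `s < t < 0`, invariant under the
translations along the Lean coordinate `1` and with vanishing coordinate-`1` component, is a
constant vector `b` with `b 1 = 0`. This is the architecture of the tree's Liouville step of
KNSS Theorem 6.2 without the Type-I decay: `W` is a bounded weak solution on `ℝ³ × (−∞, 0)`
(`isBoundedWeakNSSolutionOn_of_oseen`), its planar trace is a bounded weak solution on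
`ℝ² × (−∞, 0)` (`IsBoundedWeakNSSolutionOn.planarTrace_of_lineInvariant`), KNSS Theorem 5.1
(`KNSS2009_liouville_planar_holds`) with continuity (`planar_const_of_ae_const`) makes the
planar part constant in space, and Remark 6.1 — the planar components of the Oseen identity
read `W(t, x)ₘ = W(s, 0)ₘ − 0` (`UnboundedOperators.heatExtension_clm_comp_of_bound`,
`UnboundedOperators.heatExtension_const`, `inner_integral_oseenKernel_sub_eq_zero_of_planar_const`)
— makes it constant in time (`planar_apply_eq_of_planar_const`).

## References
* H. Koch, N. Nadirashvili, G. Seregin, V. Šverák, Acta Math. 203 (2009) 83–105 = arXiv:0709.3599, §4 (p. 8), Thm 5.1 (p. 9), Remark 6.1 (p. 11), proof of Thm 6.2 (p. 13). [KochNadirashviliSereginSverak2009]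
-/

set_option linter.dupNamespace false

noncomputable section

open MeasureTheory Set Function Filter Topology Metric
open scoped NNReal ENNReal

namespace Summit.NavierStokesRegularity.NavierStokesRegularity.Theorems.CertifiedBlowupAxisymBlowup.CompactAmplification

open Literature.Analysis Literature.Analysis.FluidPDE
open Summit.NavierStokesRegularity.NavierStokesRegularity.Theses.CertifiedBlowup

local notation "ℝ³" => EuclideanSpace ℝ (Fin 3)

open scoped RealInnerProductSpace

/-- **Remark 6.1 without decay: the planar components of `W` are constant in space–time once
the planar part is constant in space** (KNSS 2009, Remark 6.1, arXiv p. 11, in the form the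
proof of Theorem 6.2, p. 13, uses it). Let `W : ℝ → ℝ³ → ℝ³` be jointly continuous and bounded
on `(−∞, 0) × ℝ³`, satisfying the Oseen integral equation pointwise for all `s < t < 0`,
invariant under `x ↦ x + δe₁`, with planar part constant in space (`W(t, x)₀ = W(t, 0)₀`,
`W(t, x)₂ = W(t, 0)₂`). Then for `m ≠ 1` and all `s < t < 0`, `W(t, x)ₘ = W(s, 0)ₘ`: the `m`-th
component of the representation formula reads
`W(t, x)ₘ = (e^{(t−s)Δ}W(s))ₘ(x) − (B¹_s(W, W)(t))ₘ(x) = W(s, 0)ₘ − 0`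
(`UnboundedOperators.heatExtension_clm_comp_of_bound`, `UnboundedOperators.heatExtension_const`;
`inner_integral_oseenKernel_sub_eq_zero_of_planar_const` inside the time integral). This is the
`key` step of the tree's `planar_eq_zero_of_planar_const` (`KNSSTypeIRateLiouvilleMild`),
isolated. [cite: KochNadirashviliSereginSverak2009, Remark 6.1 (arXiv p. 11) and proof of Thm 6.2 (p. 13)] -/
theorem planar_apply_eq_of_planar_const {W : ℝ → ℝ³ → ℝ³}
    (hcont : ContinuousOn (uncurry W) (Iio 0 ×ˢ univ))
    (hbdd : ∃ K : ℝ, ∀ t < 0, ∀ x, ‖W t x‖ ≤ K)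
    (hmild : ∀ s t : ℝ, s < t → t < 0 → ∀ x,
      W t x = UnboundedOperators.heatExtension (W s) (t - s) x - oseenDuhamel 1 s W W t x)
    (hinv : ∀ t < 0, ∀ (x : ℝ³) (δ : ℝ), W t (x + EuclideanSpace.single 1 δ) = W t x)
    (hpl : ∀ t < 0, ∀ x, W t x 0 = W t 0 0 ∧ W t x 2 = W t 0 2)
    {m : Fin 3} (hm : m ≠ 1) : ∀ s t : ℝ, s < t → t < 0 → ∀ x, W t x m = W s 0 m := by
  obtain ⟨K, hK⟩ := hbdd
  have hK0 : 0 ≤ K := (norm_nonneg _).trans (hK (-1) (by norm_num) 0)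
  have hWc : ∀ τ < 0, Continuous (W τ) := fun τ hτ =>
    hcont.comp_continuous (f := fun x : ℝ³ => (τ, x)) (by fun_prop) fun x => ⟨hτ, mem_univ _⟩
  intro s t hst ht x
  have hs : s < 0 := hst.trans ht
  have hts : 0 < t - s := sub_pos.2 hst
  set e : ℝ³ := EuclideanSpace.single m (1 : ℝ) with he
  have hcomp : ∀ v : ℝ³, ⟪e, v⟫ = v m := fun v => by
    rw [he, EuclideanSpace.inner_single_left]; simp
  -- the free term
  have hfree : ⟪e, UnboundedOperators.heatExtension (W s) (t - s) x⟫ = W s 0 m := by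
    have h1 := UnboundedOperators.heatExtension_clm_comp_of_bound (innerSL ℝ e) (hWc s hs)
      (fun z => hK s hs z) hts x
    simp only [innerSL_apply_apply] at h1
    rw [← h1]
    have h2 : (fun z => ⟪e, W s z⟫) = fun _ => W s 0 m := by
      funext z
      rw [hcomp]
      rcases (show m = 0 ∨ m = 2 by fin_cases m <;> simp_all) with rfl | rfl
      · exact (hpl s hs z).1
      · exact (hpl s hs z).2
    rw [h2, UnboundedOperators.heatExtension_const _ hts]
  -- the Duhamel term
  have hduh : ⟪e, oseenDuhamel 1 s W W t x⟫ = 0 := by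
    have hmeas : AEStronglyMeasurable (uncurry W)
        ((volume : Measure (ℝ × ℝ³)).restrict (Ioo s t ×ˢ univ)) := by
      refine (hcont.mono ?_).aestronglyMeasurable (measurableSet_Ioo.prod MeasurableSet.univ)
      exact prod_mono (fun τ hτ => hτ.2.trans ht) subset_rfl
    have hKτ : ∀ τ ∈ Ioo s t, ∀ y, ‖W τ y‖ ≤ K := fun τ hτ y => hK τ (hτ.2.trans ht) y
    have hint := integrable_oseenKernel_duhamel_bounded one_pos hmeas hmeas hK0 hKτ hKτ hst
      le_rfl x
    rw [volume_restrict_prod_univ_eq_prod] at hint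
    have hF : Integrable (fun τ => ∫ y, oseenKernel (1 * (t - τ)) (x - y) (W τ y) (W τ y))
        (volume.restrict (Ioo s t)) := hint.integral_prod_left
    rw [oseenDuhamel_apply, ← integral_inner hF e]
    refine setIntegral_eq_zero_of_forall_eq_zero fun τ hτ => ?_
    have hτ0 : τ < 0 := hτ.2.trans ht
    have hσ : 0 < 1 * (t - τ) := by rw [one_mul]; exact sub_pos.2 hτ.2
    rw [real_inner_comm]
    exact inner_integral_oseenKernel_sub_eq_zero_of_planar_const hσ (hWc τ hτ0)
      (fun y => hK τ hτ0 y) (fun y δ => hinv τ hτ0 y δ) (fun y => hpl τ hτ0 y) x hm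
  rw [← hcomp, hmild s t hst ht x, inner_sub_right, hfree, hduh, sub_zero]

/-- **The blow-up limit with a receding symmetry axis is a constant vector** (stub
`zoom_limit_const` of the axis-aware KNSS sup-zoom). Let `W : ℝ → ℝ³ → ℝ³` be jointly
continuous and bounded on `(−∞, 0) × ℝ³`, with weakly divergence-free slices, satisfying the
Oseen integral equation `W(t) = e^{(t−s)Δ} W(s) − B¹_s(W, W)(t)` pointwise for all `s < t < 0`,
invariant under the translations `x ↦ x + δe₁` along the Lean coordinate `1`, and with
`W(t, x)₁ = 0`. Then `W ≡ b` on `(−∞, 0) × ℝ³` for a constant vector `b` with `b₁ = 0`. Proof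
(KNSS 2009, proof of Theorem 6.2, p. 13, without the decay): `W` is a bounded weak solution on
`ℝ³ × (−∞, 0)` (`isBoundedWeakNSSolutionOn_of_oseen`, §4 (i)–(ii)), its planar trace
`V(t, y) = (W₀, W₂)(t, (y₀, 0, y₁))` is a bounded weak solution on `ℝ² × (−∞, 0)`
(`IsBoundedWeakNSSolutionOn.planarTrace_of_lineInvariant`), Theorem 5.1
(`KNSS2009_liouville_planar_holds`) and continuity (`planar_const_of_ae_const`) make the planar
part constant in space, Remark 6.1 (`planar_apply_eq_of_planar_const`) makes it constant in
time, and the axial component vanishes by hypothesis. [cite: KochNadirashviliSereginSverak2009, proof of Thm 6.2 (arXiv p. 13) with Thm 5.1 (p. 9) and Remark 6.1 (p. 11)] -/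
theorem zoom_limit_const : ∀ (W : ℝ → ℝ³ → ℝ³),
    ContinuousOn (uncurry W) (Iio 0 ×ˢ univ) → (∃ K : ℝ, ∀ t < 0, ∀ x, ‖W t x‖ ≤ K) →
    (∀ t < 0, IsWeaklyDivFree (W t)) →
    (∀ s t : ℝ, s < t → t < 0 → ∀ x,
      W t x = UnboundedOperators.heatExtension (W s) (t - s) x - oseenDuhamel 1 s W W t x) →
    (∀ t < 0, ∀ (x : ℝ³) (δ : ℝ), W t (x + EuclideanSpace.single 1 δ) = W t x) →
    (∀ t < 0, ∀ x, W t x 1 = 0) →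
    ∃ b : ℝ³, b 1 = 0 ∧ ∀ t < 0, ∀ x, W t x = b := by
  intro W hcont hbdd hdiv hmild hinv h1
  -- `W` is a bounded weak solution on `ℝ³ × (−∞, 0)`, its planar trace one on `ℝ² × (−∞, 0)`
  have hmild' : ∀ s t : ℝ, s < t → t < 0 → ∀ x, W t x =
      UnboundedOperators.heatExtension (W s) (1 * (t - s)) x - oseenDuhamel 1 s W W t x := by
    intro s t hst ht x
    rw [one_mul]
    exact hmild s t hst ht x
  have hweak := isBoundedWeakNSSolutionOn_of_oseen one_pos hcont hbdd hdiv hmild'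
  have hV := hweak.planarTrace_of_lineInvariant hcont (fun t ht => hinv t ht) fun t ht => hdiv t ht
  -- Theorem 5.1 and continuity: the planar part is constant in space
  obtain ⟨β, -, -, hae⟩ := KNSS2009_liouville_planar_holds hV
  have hpl := planar_const_of_ae_const hcont hinv hae
  -- Remark 6.1: the planar part is constant in time as well
  have hconst : ∀ {m : Fin 3}, m ≠ 1 → ∀ t < 0, ∀ x, W t x m = W (-2) 0 m := by
    intro m hm t ht x
    have hst : min t (-2) - 1 < t := by linarith [min_le_left t (-2)]
    have hs2 : min t (-2) - 1 < -2 := by linarith [min_le_right t (-2)]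
    rw [planar_apply_eq_of_planar_const hcont hbdd hmild hinv hpl hm _ t hst ht x,
      planar_apply_eq_of_planar_const hcont hbdd hmild hinv hpl hm _ (-2) hs2 (by norm_num) 0]
  refine ⟨EuclideanSpace.single 0 (W (-2) 0 0) + EuclideanSpace.single 2 (W (-2) 0 2),
    by simp, fun t ht x => ?_⟩
  ext i
  fin_cases i
  · simpa using hconst (by decide) t ht x
  · simpa using h1 t ht x
  · simpa using hconst (by decide) t ht x

end Summit.NavierStokesRegularity.NavierStokesRegularity.Theorems.CertifiedBlowupAxisymBlowup.CompactAmplification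

end
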